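import Mathlib

/-!
# Crux `WordLengthQP` (stmt-ValiantsHypothesis-6623), line `Sketch` (eps-order-ladder) —
the GENERAL one-walk normal form of rung 1 (seat c4)

Rung `q = 1` of the ε-order ladder in tangent form (`rungOne_normal_form`, p119541):
`f = Σ_{t<L} βᵀ A_{<t} B_t A_{>t} α` over ONE exact skeleton `A₁ ⋯ A_L` with `βᵀ (∏A) α = 0`
(boundary `β = α = e₀` for a whole program; general `β`, `α` for a window).  Seat c3 proved the
one-walk quadratic normal form for UNIT-DETERMINANT skeletons (`rungOne_oneWalk_normal_form`,
p121679, via inverses).  Here is the division-free version for ARBITRARY skeleton letters —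
singular and non-unit-determinant letters included:

  `w_i · f = α_i · Σ_{t<L} D_{>t} · Q_t(r_t)`,   `i = 0, 1`,

where `r_t = βᵀ A_{<t}` is the prefix ROW WALK, `Q_t(r) = r · (B_t J A_tᵀ) · rᵀ` a binary
quadratic form with entries of degree `≤ 2`, `D_{>t} = ∏_{s>t} det A_s` the suffix determinant,
`u = (∏A)ᵀ β` the final row and `w = J u = (−u₁, u₀)`, `J = !![0,-1;1,0]`
(`oneWalk_general`; for `β = α = e₀`: `−(∏A)₀₁ · f = Σ_t D_{>t} Q_t(r_t)`,
`oneWalk_general_entry`).  Mechanism: the suffix columns are forced onto the line `J r_{t+1}ᵀ`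
by the single constraint `βᵀ(∏A)α = 0` (`oneWalk_suffix_parallel`, from `A J Aᵀ = det A · J`).
Consequences recorded on the line card: terms left of a singular letter drop out of the right-hand
side (`D_{>t} = 0` — the cut of `stub_rankOneCut` seen from the walk), and between non-unit
letters the terms are weighted `δ`-adically by the determinants still to come.
-/

-- `Summit.ValiantsHypothesis.ValiantsHypothesis.…` is the tree's mandated single-conjunct layout
-- (Sub = Summit), so the duplicated namespace component is intended.
set_option linter.dupNamespace false

noncomputable section

namespace Summit.ValiantsHypothesis.ValiantsHypothesis.Cruxes.WordLengthQP.EpsOrderLadder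

open Matrix

/-- `A · J · Aᵀ = det A · J` for `2 × 2` matrices, `J = !![0,-1;1,0]`. [folklore] -/
theorem oneWalk_mul_J_mul_transpose {R : Type} [CommRing R] (A : Matrix (Fin 2) (Fin 2) R) :
    A * !![0, -1; 1, 0] * Aᵀ = A.det • !![0, -1; 1, 0] := by
  ext i j
  rw [Matrix.det_fin_two]
  fin_cases i <;> fin_cases j <;>
    simp [Matrix.mul_apply, Fin.sum_univ_two, Matrix.transpose_apply] <;> ring

/-- In the plane, `α ⊥ u` forces `α ∥ J u`: `(J u)_i α_j = α_i (J u)_j`, written as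
`(J u)_i • α = α_i • J u`. [folklore] -/
theorem oneWalk_parallel_base {R : Type} [CommRing R] (α u : Fin 2 → R) (h : α ⬝ᵥ u = 0)
    (i : Fin 2) : (!![0, -1; 1, 0] *ᵥ u) i • α = α i • (!![0, -1; 1, 0] *ᵥ u) := by
  have h' : α 0 * u 0 + α 1 * u 1 = 0 := by simpa [dotProduct, Fin.sum_univ_two] using h
  ext j
  fin_cases i <;> fin_cases j <;> simp [Matrix.mulVec, dotProduct, Fin.sum_univ_two] <;>
    first
    | ring1
    | linear_combination h'
    | linear_combination (-1 : R) * h'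

/-- **Suffix columns are parallel to the rotated prefix row.**  For a suffix `S` after a prefix
matrix `M` (so `∏A = M · ∏S`), if `α ⊥ (∏A)ᵀβ` then
`w_i • (∏S) α = (α_i · ∏_{A∈S} det A) • J (Mᵀ β)` with `w = J (∏A)ᵀ β`. [folklore] -/
theorem oneWalk_suffix_parallel {R : Type} [CommRing R] (β α : Fin 2 → R)
    (S : List (Matrix (Fin 2) (Fin 2) R)) :
    ∀ M : Matrix (Fin 2) (Fin 2) R, α ⬝ᵥ (β ᵥ* (M * S.prod)) = 0 → ∀ i : Fin 2,
      (!![0, -1; 1, 0] *ᵥ (β ᵥ* (M * S.prod))) i • (S.prod *ᵥ α) =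
        (α i * (S.map Matrix.det).prod) • (!![0, -1; 1, 0] *ᵥ (β ᵥ* M)) := by
  induction S with
  | nil =>
    intro M h i
    simp only [List.prod_nil, mul_one, List.map_nil, one_mulVec] at h ⊢
    exact oneWalk_parallel_base α _ h i
  | cons A S ih =>
    intro M h i
    have hMA : M * (A :: S).prod = M * A * S.prod := by rw [List.prod_cons, Matrix.mul_assoc]
    rw [hMA] at h ⊢
    have key := ih (M * A) h i
    rw [List.prod_cons, ← Matrix.mulVec_mulVec, ← Matrix.mulVec_smul, key, Matrix.mulVec_smul,
      List.map_cons, List.prod_cons]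
    -- `A (J (Aᵀ Mᵀβ)) = det A • J (Mᵀ β)`
    have hrow : β ᵥ* (M * A) = Aᵀ *ᵥ (β ᵥ* M) := by
      rw [← Matrix.vecMul_vecMul, Matrix.mulVec_transpose]
    rw [hrow, Matrix.mulVec_mulVec, Matrix.mulVec_mulVec, oneWalk_mul_J_mul_transpose,
      Matrix.smul_mulVec, smul_smul]
    congr 1
    ring

/-- **General one-walk normal form of rung 1** (arbitrary skeleton letters).  With
`r_t = βᵀ A_{<t}`, `D_{>t} = ∏_{s>t} det A_s`, `Q_t(r) = r (B_t J A_tᵀ) rᵀ`, `u = (∏A)ᵀβ`,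
`w = J u`: if `βᵀ (∏A) α = 0` then `w_i · Σ_t βᵀA_{<t}B_tA_{>t}α = α_i · Σ_t D_{>t} Q_t(r_t)`
for `i = 0, 1`. [folklore] -/
theorem oneWalk_general {R : Type} [CommRing R] (As Bs : List (Matrix (Fin 2) (Fin 2) R))
    (β α : Fin 2 → R) (h0 : β ⬝ᵥ (As.prod *ᵥ α) = 0) (i : Fin 2) :
    (!![0, -1; 1, 0] *ᵥ (β ᵥ* As.prod)) i *
        ∑ t ∈ Finset.range As.length,
          β ⬝ᵥ (((As.take t).prod * Bs.getD t 0 * (As.drop (t + 1)).prod) *ᵥ α) =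
      α i * ∑ t ∈ Finset.range As.length,
        ((As.drop (t + 1)).map Matrix.det).prod *
          ((β ᵥ* (As.take t).prod) ⬝ᵥ
            ((Bs.getD t 0 * !![0, -1; 1, 0] * (As.getD t 0)ᵀ) *ᵥ (β ᵥ* (As.take t).prod))) := by
  rw [Finset.mul_sum, Finset.mul_sum]
  refine Finset.sum_congr rfl fun t ht => ?_
  rw [Finset.mem_range] at ht
  -- the suffix after position `t`, with prefix matrix `A_{<t} · A_t = (As.take (t+1)).prod`
  have hsplit : (As.take (t + 1)).prod * (As.drop (t + 1)).prod = As.prod := by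
    rw [← List.prod_append, List.take_append_drop]
  have htake : (As.take (t + 1)).prod = (As.take t).prod * As.getD t 0 := by
    rw [List.take_add_one, List.prod_append, List.getD_eq_getElem?_getD,
      List.getElem?_eq_getElem ht]
    simp
  have h0' : α ⬝ᵥ (β ᵥ* ((As.take (t + 1)).prod * (As.drop (t + 1)).prod)) = 0 := by
    rw [hsplit, dotProduct_comm, ← Matrix.dotProduct_mulVec, h0]
  have key := oneWalk_suffix_parallel β α (As.drop (t + 1)) ((As.take (t + 1)).prod) h0' i
  rw [hsplit] at key
  -- `βᵀ (U B V) α = (βᵀ U B) · (V α)`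
  have hterm : β ⬝ᵥ (((As.take t).prod * Bs.getD t 0 * (As.drop (t + 1)).prod) *ᵥ α) =
      (β ᵥ* ((As.take t).prod * Bs.getD t 0)) ⬝ᵥ ((As.drop (t + 1)).prod *ᵥ α) := by
    rw [← Matrix.mulVec_mulVec, Matrix.dotProduct_mulVec]
  rw [hterm, ← smul_eq_mul (a := (!![0, -1; 1, 0] *ᵥ (β ᵥ* As.prod)) i), ← dotProduct_smul, key,
    dotProduct_smul, smul_eq_mul, htake, ← Matrix.vecMul_vecMul, ← Matrix.vecMul_vecMul,
    ← Matrix.mulVec_transpose (As.getD t 0), Matrix.mulVec_mulVec, ← Matrix.dotProduct_mulVec,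
    Matrix.mulVec_mulVec, ← Matrix.mul_assoc, mul_assoc]

/-- **The `(0,0)`-entry form** (whole program, `β = α = e₀`): if `(∏A)₀₀ = 0` then
`−(∏A)₀₁ · Σ_t (A_{<t} B_t A_{>t})₀₀ = Σ_t D_{>t} · Q_t(r_t)` with `r_t` the row `0` of
`A_{<t}` — for unit determinants this is `rungOne_oneWalk_normal_form` (p121679) up to the
constant `(∏A)₀₁ ∈ ℂˣ`; in general the terms left of a singular letter drop out of the right-hand
side and the others are weighted by the determinants still to come. [folklore] -/
theorem oneWalk_general_entry {R : Type} [CommRing R] (As Bs : List (Matrix (Fin 2) (Fin 2) R))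
    (h0 : As.prod 0 0 = 0) :
    -(As.prod 0 1) *
        ∑ t ∈ Finset.range As.length,
          ((As.take t).prod * Bs.getD t 0 * (As.drop (t + 1)).prod) 0 0 =
      ∑ t ∈ Finset.range As.length,
        ((As.drop (t + 1)).map Matrix.det).prod *
          ((fun k => (As.take t).prod 0 k) ⬝ᵥ
            ((Bs.getD t 0 * !![0, -1; 1, 0] * (As.getD t 0)ᵀ) *ᵥ fun k => (As.take t).prod 0 k)) := by
  have hβ : ∀ M : Matrix (Fin 2) (Fin 2) R, (Pi.single 0 1 : Fin 2 → R) ᵥ* M = fun k => M 0 k := by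
    intro M
    ext k
    simp [Matrix.vecMul, dotProduct, Fin.sum_univ_two]
  have hentry : ∀ M : Matrix (Fin 2) (Fin 2) R,
      (Pi.single 0 1 : Fin 2 → R) ⬝ᵥ (M *ᵥ (Pi.single 0 1 : Fin 2 → R)) = M 0 0 := by
    intro M
    simp [Matrix.mulVec, dotProduct, Fin.sum_univ_two]
  have h := oneWalk_general As Bs (Pi.single 0 1) (Pi.single 0 1) (by rw [hentry, h0]) 0
  simp only [hentry, hβ, Pi.single_eq_same, one_mul] at h
  rw [← h]
  congr 1
  simp [Matrix.mulVec, dotProduct, Fin.sum_univ_two]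

end Summit.ValiantsHypothesis.ValiantsHypothesis.Cruxes.WordLengthQP.EpsOrderLadder
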